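import Literature.RepresentationTheory.FiniteGroups.VirtualBrauerDescent
import HarnessLib

/-!
# Brauer–Taylor descent for `PotentialCompanionDescent.BrauerTaylorDescent` — the descended representation restricts to the `rⱼ`

Part 3b of the lineage programme (Barnet-Lamb–Gee–Geraghty–Taylor 2014, proof of Thm. 5.5.1).
`Representation.exists_irreducible_virtualBrauerDescent` produces, from data
`(Hᵢ ⊇ N, rᵢ, ψᵢ, nᵢ)`, an irreducible `W` with the Hom formula
`dim Hom(σ, W) = ∑ᵢ nᵢ dim Hom(σ, coind(rᵢ ⊗ ψᵢ))` and `dim W = dim rⱼ`.  Here we add the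
identification BLGGT use tacitly ("`r|_{G_{Fⱼ}} ≅ rⱼ`"):

* `nonempty_equiv_comp_subtype_of_homFormula`: **`rⱼ ≃ W|_{Hⱼ}` for every `j`**, provided the
  single-index pairing `∑ᵢ nᵢ dim Hom_G(coind_{Hⱼ} k, coind_{Hᵢ} k(ψᵢ)) = 1` holds (it does for
  Brauer data, `…SinglePairing`).

Proof: `dim Hom_{Hⱼ}(rⱼ, W|_{Hⱼ}) = dim Hom_G(coind rⱼ, W)` (Frobenius reciprocity for the
finite-index coinduction) `= ∑ᵢ nᵢ dim Hom_G(coind rⱼ, coind(rᵢ ⊗ ψᵢ))` (Hom formula)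
`= ∑ᵢ nᵢ ∑_{q ∈ Hⱼ\G/Hᵢ} dim Hom(rⱼ^{g_q}|, (rᵢ ⊗ ψᵢ)|)` (Mackey) `= ∑ᵢ nᵢ #{q : ψᵢ = 1 on
Hᵢ ∩ g_q⁻¹Hⱼg_q}` (the local term: `rⱼ^{g}| ≅ rᵢ|` irreducible on `N`, twist-Schur)
`= ∑ᵢ nᵢ dim Hom_G(coind_{Hⱼ} k, coind_{Hᵢ} k(ψᵢ)) = 1`; a non-zero `Hⱼ`-map `rⱼ → W` is injective
(`rⱼ` irreducible) between spaces of the same dimension, hence an isomorphism.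

References: BLGGT, Ann. of Math. 179 (2014), proof of Thm. 5.5.1 (arXiv:1010.2561 Thm. 5.4.1);
Serre, *Linear Representations of Finite Groups*, §7.2–§7.4.
-/

set_option linter.dupNamespace false

noncomputable section

open scoped BigOperators
open Literature.RepresentationTheory.FiniteGroups Literature.RepresentationTheory.Semisimple

namespace Summit.Langlands.Langlands.Theorems.BrauerTaylorDescent

/-! ## Mackey count for induced degree-one characters (finite index, any group) -/

section Count

variable {k : Type} [Field k] [IsAlgClosed k] {G : Type} [Group G]

open scoped Classical in
/-- **`dim_k Hom_G(coind_S k(α), coind_T k(β)) = #{q ∈ S\G/T : α^{g_q} = β on T ∩ g_q⁻¹ S g_q}`**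
for a finite-index `S ≤ G` of an arbitrary group (the finite-group case is
`finrank_intertwiningMap_coind_ofChar`; same proof: `finrank_intertwiningMap_coind_coind` + the
local term `finrank_intertwiningMap_twist_twist_of_equiv`). [cite: BarnetlambEtAl2014, § 5.5 preamble] -/
theorem finrank_intertwiningMap_coind_ofChar_of_finiteIndex (S T : Subgroup G) [S.FiniteIndex]
    (α : S →* kˣ) (β : T →* kˣ) :
    Module.finrank k (Representation.IntertwiningMap
        (Representation.coind S.subtype (Representation.ofChar α))
        (Representation.coind T.subtype (Representation.ofChar β))) =
      ∑ q : DoubleCoset.Quotient (S : Set G) (T : Set G),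
        (if α.comp (mackeyConjHom S T q.out) = β.comp (mackeySubgroup S T q.out).subtype
          then 1 else 0) := by
  classical
  rw [finrank_intertwiningMap_coind_coind]
  refine Finset.sum_congr rfl fun q _ => ?_
  have hirr : Representation.IsIrreducible
      (((Representation.trivial k T k).comp (mackeySubgroup S T q.out).subtype).comp
        (1 : mackeySubgroup S T q.out →* mackeySubgroup S T q.out)) := by
    haveI : IsSimpleModule k k := isSimpleModule_iff_finrank_eq_one.2 (Module.finrank_self k)
    exact Representation.isIrreducible_of_isSimpleModule _
  have h := finrank_intertwiningMap_twist_twist_of_equiv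
    (1 : mackeySubgroup S T q.out →* mackeySubgroup S T q.out)
    (Representation.Equiv.refl
      ((Representation.trivial k T k).comp (mackeySubgroup S T q.out).subtype))
    hirr (α.comp (mackeyConjHom S T q.out)) (β.comp (mackeySubgroup S T q.out).subtype)
    (fun m => by rw [MonoidHom.one_apply, map_one]) (fun m => by rw [MonoidHom.one_apply, map_one])
  rw [show mackeyConjRep S T (Representation.ofChar α) q.out =
      Representation.twist ((Representation.trivial k T k).comp (mackeySubgroup S T q.out).subtype)
        (α.comp (mackeyConjHom S T q.out)) from MonoidHom.ext fun _ => rfl,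
    show ((Representation.ofChar β).comp (mackeySubgroup S T q.out).subtype :
        Representation k (mackeySubgroup S T q.out) k) =
      Representation.twist ((Representation.trivial k T k).comp (mackeySubgroup S T q.out).subtype)
        (β.comp (mackeySubgroup S T q.out).subtype) from Representation.twist_comp _ _ _, h]
  by_cases hc : α.comp (mackeyConjHom S T q.out) = β.comp (mackeySubgroup S T q.out).subtype
  · rw [if_pos hc, if_pos (by
      rw [hc]; ext1 x
      rw [MonoidHom.mul_apply, MonoidHom.inv_apply, MonoidHom.one_apply, mul_inv_cancel])]
  · rw [if_neg hc, if_neg fun h' => hc (by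
      ext1 x
      have := DFunLike.congr_fun h' x
      rw [MonoidHom.mul_apply, MonoidHom.inv_apply, MonoidHom.one_apply, mul_inv_eq_one] at this
      exact this.symm)]

end Count

/-! ## `W|_{Hⱼ} ≅ rⱼ` -/

section Restriction

variable {k : Type} [Field k] [IsAlgClosed k] {G : Type} [Group G]
  {ι : Type} [Fintype ι] (H : ι → Subgroup G) [∀ i, (H i).FiniteIndex]
  (N : Subgroup G) [N.Normal] (hNH : ∀ i, N ≤ H i)
  {A : ι → Type} [∀ i, AddCommGroup (A i)] [∀ i, Module k (A i)]
  [∀ i, FiniteDimensional k (A i)]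
  (r : ∀ i, Representation k (H i) (A i)) (ψ : ∀ i, H i →* kˣ) (n : ι → ℤ)

omit [Fintype ι] [∀ i, (H i).FiniteIndex] in
open scoped Classical in
/-- **The local term**: `dim Hom_{Hᵢ ∩ g⁻¹Hⱼg}(rⱼ^{g}|, (rᵢ ⊗ ψᵢ)|) = [ψᵢ = 1 on Hᵢ ∩ g⁻¹Hⱼg]`
(`rⱼ^{g}| ≅ rᵢ|` by `hiso`, irreducible on `N` by `hr`; twist-Schur
`finrank_intertwiningMap_twist_twist_of_equiv`). [cite: BarnetlambEtAl2014, proof of Thm. 5.5.1] -/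
theorem finrank_intertwiningMap_mackeyConjRep_twist
    (hψ : ∀ i (x : H i), (x : G) ∈ N → ψ i x = 1)
    (hr : ∀ i, Representation.IsIrreducible ((r i).comp (Subgroup.inclusion (hNH i))))
    (hiso : ∀ i j (g : G), Nonempty (Representation.Equiv (mackeyConjRep (H i) (H j) (r i) g)
      ((r j).comp (mackeySubgroup (H i) (H j) g).subtype)))
    (j i : ι) (g : G) :
    Module.finrank k (Representation.IntertwiningMap (mackeyConjRep (H j) (H i) (r j) g)
        ((Representation.twist (r i) (ψ i)).comp (mackeySubgroup (H j) (H i) g).subtype)) =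
      if (ψ i).comp (mackeySubgroup (H j) (H i) g).subtype = 1 then 1 else 0 := by
  classical
  obtain ⟨e⟩ := hiso j i g
  have hirr : Representation.IsIrreducible
      (((r i).comp (mackeySubgroup (H j) (H i) g).subtype).comp (normalToMackey H N hNH j i g)) :=
    hr i
  have h := finrank_intertwiningMap_twist_twist_of_equiv (normalToMackey H N hNH j i g) e hirr 1
    ((ψ i).comp (mackeySubgroup (H j) (H i) g).subtype) (fun _ => rfl) (fun m => hψ i _ m.2)
  rw [Representation.twist_one] at h
  rw [Representation.twist_comp, h]
  refine if_congr ⟨fun hh => ?_, fun hh => ?_⟩ rfl rfl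
  · ext1 x
    have := DFunLike.congr_fun hh x
    rw [MonoidHom.mul_apply, MonoidHom.inv_apply, MonoidHom.one_apply, inv_one, mul_one] at this
    rw [this, MonoidHom.one_apply]
  · rw [hh]
    ext1 x
    rw [MonoidHom.mul_apply, MonoidHom.inv_apply, MonoidHom.one_apply, inv_one, mul_one]

/-- **`rⱼ ≃ W|_{Hⱼ}`.**  Let `W` be a finite-dimensional representation of `G` satisfying the Hom
formula `dim Hom(σ, W) = ∑ᵢ nᵢ dim Hom(σ, coind(rᵢ ⊗ ψᵢ))` of
`Representation.exists_irreducible_virtualBrauerDescent` and `dim W = dim rⱼ`, for data with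
`rᵢ|_N` irreducible, `rᵢ^g| ≅ rⱼ|` (`hiso`), `ψᵢ` trivial on `N`, and the single-index pairing
`∑ᵢ nᵢ dim Hom_G(coind_{Hⱼ} k, coind_{Hᵢ} k(ψᵢ)) = 1`.  Then `rⱼ ≅ W|_{Hⱼ}`
(BLGGT: "`r|_{G_{F_j}} ≅ r_j`"). [cite: BarnetlambEtAl2014, proof of Thm. 5.5.1] -/
theorem nonempty_equiv_comp_subtype_of_homFormula
    (hψ : ∀ i (x : H i), (x : G) ∈ N → ψ i x = 1)
    (hr : ∀ i, Representation.IsIrreducible ((r i).comp (Subgroup.inclusion (hNH i))))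
    (hiso : ∀ i j (g : G), Nonempty (Representation.Equiv (mackeyConjRep (H i) (H j) (r i) g)
      ((r j).comp (mackeySubgroup (H i) (H j) g).subtype)))
    (hone : ∀ j, (∑ i, n i * (Module.finrank k (Representation.IntertwiningMap
        (Representation.coind (H j).subtype (Representation.ofChar (1 : H j →* kˣ)))
        (Representation.coind (H i).subtype (Representation.ofChar (ψ i)))) : ℤ)) = 1)
    {X : Type} [AddCommGroup X] [Module k X] [FiniteDimensional k X] (W : Representation k G X)
    (hW : ∀ {Y : Type} [AddCommGroup Y] [Module k Y] [FiniteDimensional k Y]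
        (σ : Representation k G Y),
        (Module.finrank k (Representation.IntertwiningMap σ W) : ℤ) =
          ∑ i, n i * (Module.finrank k (Representation.IntertwiningMap σ
            (Representation.coind (H i).subtype (Representation.twist (r i) (ψ i)))) : ℤ))
    (j : ι) (hdim : Module.finrank k X = Module.finrank k (A j)) :
    Nonempty (Representation.Equiv (r j) (W.comp (H j).subtype)) := by
  classical
  -- `dim Hom_{Hⱼ}(rⱼ, W|_{Hⱼ}) = 1`
  have h1 : (Module.finrank k
      (Representation.IntertwiningMap (r j) (W.comp (H j).subtype)) : ℤ) = 1 := by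
    rw [← (Representation.IntertwiningMap.coindLeftEquiv (H j) (r j) W).finrank_eq, hW,
      ← hone j]
    refine Finset.sum_congr rfl fun i _ => ?_
    congr 1
    rw [finrank_intertwiningMap_coind_coind, finrank_intertwiningMap_coind_ofChar_of_finiteIndex]
    push_cast
    refine Finset.sum_congr rfl fun q _ => ?_
    rw [finrank_intertwiningMap_mackeyConjRep_twist H N hNH r ψ hψ hr hiso j i q.out,
      MonoidHom.one_comp]
    by_cases hc : (ψ i).comp (mackeySubgroup (H j) (H i) q.out).subtype = 1
    · rw [if_pos hc, if_pos hc.symm, Nat.cast_one]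
    · rw [if_neg hc, if_neg fun h => hc h.symm, Nat.cast_zero]
  have h1' : Module.finrank k
      (Representation.IntertwiningMap (r j) (W.comp (H j).subtype)) = 1 := by
    exact_mod_cast h1
  haveI : Nontrivial (Representation.IntertwiningMap (r j) (W.comp (H j).subtype)) :=
    Module.nontrivial_of_finrank_pos (R := k) (by omega)
  obtain ⟨f, hf⟩ := exists_ne (0 : Representation.IntertwiningMap (r j) (W.comp (H j).subtype))
  haveI : (r j).IsIrreducible :=
    Representation.isIrreducible_of_comp (Subgroup.inclusion (hNH j)) (r j) (hr j)
  have hinj : Function.Injective f :=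
    (Representation.IsIrreducible.injective_or_eq_zero f).resolve_right hf
  have hsurj : Function.Surjective f :=
    (LinearMap.injective_iff_surjective_of_finrank_eq_finrank (f := f.toLinearMap) hdim.symm).1
      hinj
  exact ⟨f.ofBijective ⟨hinj, hsurj⟩⟩

end Restriction

end Summit.Langlands.Langlands.Theorems.BrauerTaylorDescent

end
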